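import Literature.AnabelianGeometry.SemiGraphs.PSCIrreducibleMultiNodalShape
import Literature.AnabelianGeometry.SemiGraphs.PSCTwoComponentAffineOrigin
import HarnessLib

/-!
# [CombGC] Prop. 1.2 (i), [IUTchI] Rmk. 1.2.3 (iv) (cuspidal), [CombGC] Thm. 1.6 (i) at irreducible data with several self-nodes

Mochizuki, *A combinatorial version of the Grothendieck conjecture* [CombGC] §1: Prop. 1.2 (i) p. 8, Thm.
1.6 (i) p. 13; *Inter-universal Teichmüller theory I* [IUTchI] Rmk. 1.2.3 (iv) pp. 41–42
[cite: MochizukiCombGC2007, Thm 1.6(i) p.13] [cite: MochizukiCombGC2007, Prop 1.2(i) p.8]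
[cite: Mochizuki2012, IUTchI Rmk 1.2.3(iv) pp.41-42].  PROOF-ONLY assembly (abc-iut-f-164 gen 2; rows F-0459
`PSCDatum.OpenInterDeterminesComponentHolds`, F-1931 `PSCDatum.CuspidalEdgeLikeCharacterizationHolds`, F-0458
`PSCDatum.NumericallyCuspidalIffHolds`) at the DATA OF IRREDUCIBLE `k`-NODAL SHAPE
(`PSCIrreducibleMultiNodalShape.lean`: one vertex with `k ≤ g` loops; `Π` a pro-`Σ` completion
`ι : Γ_{g,r} → Π` of the smoothing, node groups `closure ι⟨b_m⟩` (`m < k`), cusp groups `closure ι⟨c_j⟩`,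
vertex group `closure ι⟨b_m, a_m b_m a_m⁻¹ (m < k), a_i, b_i (i ≥ k), c_j⟩`, genus `g − k`; `(g, r)`
hyperbolic) — the deeper strata of `Δ_irr`, arbitrarily many nodes.

* `exists_irreducibleMultiNodalDatum`: the shape is INHABITED over the pro-`Σ` completion of every `Γ_{g,r}`,
  every `k ≤ g` (`V = Unit`, `N = Fin k`, `C = Fin r`).
* `openInterDeterminesComponentHolds_of_irreducibleMultiNodal`, `numericallyCuspidalIffHolds_of_irreducibleMultiNodal`:
  F-0459 and F-0458 (`Σ = {l}`) at every origin of such data (F-1931: the vertex-free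
  `cuspidalEdgeLikeCharacterizationHolds_of_cuspidallyStandard`).
* `exists_irreducibleMultiNodalOrigin_thm16i_holds`: for a prime `l`, the origin of these data with `Σ = {l}`
  satisfies F-0459 ∧ F-1931 ∧ F-0458 and is INHABITED by the pro-`l` datum of the MAXIMALLY DEGENERATE
  ONE-POINTED IRREDUCIBLE CURVE OF GENUS 2 (`Γ_{2,1}`, `k = 2`: a rational curve with two nodes and one
  marked point).

Instance forms at data of the shape of genuine irreducible nodal curves; consistency evidence for the typed
rows, not the printed theorems for all pointed stable curves.  Nothing here takes a side on [IUTchIII]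
Cor. 3.12.
-/

noncomputable section

namespace Literature.AnabelianGeometry.SemiGraphs

open scoped Pointwise
open Literature.GroupTheory.CombinatorialGroupTheory
open SemiGraphOfAnabelioids (IsProSigmaCompletion)

universe u

namespace PSCDatum

/-! ### Data of irreducible `k`-nodal shape exist -/

/-- **Data of irreducible `k`-nodal shape exist** over a pro-`Σ` completion `ι : Γ_{g,r} → Π`, `k ≤ g`:
one vertex, nodes `Fin k` (loops) with `Π_{ν_m} = closure ι⟨b_m⟩`, cusps `Fin r`, vertex group
`closure ι⟨b_m, a_m b_m a_m⁻¹ (m < k), a_i, b_i (i ≥ k), c_j⟩` (the surface cut open along the `k`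
curves), genus `g − k`; both branches of each loop embed its node group with trivial conjugator.
[cite: MochizukiCombGC2007, Def 1.1 pp.6-7] -/
theorem exists_irreducibleMultiNodalDatum (Sigma : Set ℕ) (hne : Sigma.Nonempty)
    (hprime : ∀ p ∈ Sigma, p.Prime) (g r k : ℕ) (hk : k ≤ g) :
    ∃ (Q : ProfiniteGrp.{0}) (ι : PuncturedSurfaceGroup g r →* Q) (G : PSCDatum Q)
      (e : G.graph.C ≃ Fin r) (v₀ : G.graph.V) (eN : G.graph.N ≃ Fin k),
      IsProSigmaCompletion Sigma ι ∧ G.Sigma = Sigma ∧ G.graph.i = 1 ∧ G.graph.n = k ∧ G.graph.r = r ∧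
      (∀ c, G.cuspGp c =
        ((PuncturedSurfaceGroup.cuspInertia (g := g) (e c)).map ι).topologicalClosure) ∧
      (∀ w, w = v₀) ∧
      (∀ m, G.nodeGp m = ((Subgroup.zpowers
        (PuncturedSurfaceGroup.b (r := r) (Fin.castLE hk (eN m)))).map ι).topologicalClosure) ∧
      G.vertGp v₀ = ((Subgroup.closure {x : PuncturedSurfaceGroup g r |
            (∃ m : Fin k, x = PuncturedSurfaceGroup.b (Fin.castLE hk m) ∨
              x = PuncturedSurfaceGroup.a (Fin.castLE hk m) * PuncturedSurfaceGroup.b (Fin.castLE hk m) *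
                (PuncturedSurfaceGroup.a (Fin.castLE hk m))⁻¹) ∨
            (∃ i : Fin g, k ≤ (i : ℕ) ∧ (x = PuncturedSurfaceGroup.a i ∨ x = PuncturedSurfaceGroup.b i)) ∨
            ∃ j : Fin r, x = PuncturedSurfaceGroup.c j}).map ι).topologicalClosure ∧
      G.genus v₀ = g - k ∧ (∀ n, G.graph.nodeEnds n = s(v₀, v₀)) := by
  classical
  obtain ⟨Q, ι, hι⟩ :=
    IsProSigmaCompletion.exists_isProSigmaCompletion (PuncturedSurfaceGroup g r) Sigma
  let S₀ : Set (PuncturedSurfaceGroup g r) := {x |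
    (∃ m : Fin k, x = PuncturedSurfaceGroup.b (Fin.castLE hk m) ∨
      x = PuncturedSurfaceGroup.a (Fin.castLE hk m) * PuncturedSurfaceGroup.b (Fin.castLE hk m) *
        (PuncturedSurfaceGroup.a (Fin.castLE hk m))⁻¹) ∨
    (∃ i : Fin g, k ≤ (i : ℕ) ∧ (x = PuncturedSurfaceGroup.a i ∨ x = PuncturedSurfaceGroup.b i)) ∨
    ∃ j : Fin r, x = PuncturedSurfaceGroup.c j}
  let A₀ : Subgroup Q := ((Subgroup.closure S₀).map ι).topologicalClosure
  have hN₀ : ∀ m : Fin k, ((Subgroup.zpowers (PuncturedSurfaceGroup.b (r := r) (Fin.castLE hk m))).map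
      ι).topologicalClosure ≤ A₀ := fun m =>
    Subgroup.topologicalClosure_mono (Subgroup.map_mono ((Subgroup.zpowers_le).mpr
      (Subgroup.subset_closure (Or.inl ⟨m, Or.inl rfl⟩))))
  let T : PSCDatum Q :=
    { Sigma := Sigma
      sigma_prime := hprime
      sigma_nonempty := hne
      graph := { V := Unit, N := Fin k, C := Fin r, nodeEnds := fun _ => s((), ()), cuspEnd := fun _ => () }
      vertGp := fun _ => A₀
      nodeGp := fun m => ((Subgroup.zpowers (PuncturedSurfaceGroup.b (r := r) (Fin.castLE hk m))).map
        ι).topologicalClosure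
      cuspGp := fun j => ((PuncturedSurfaceGroup.cuspInertia (g := g) j).map ι).topologicalClosure
      genus := fun _ => g - k
      isClosed_vertGp := fun _ => Subgroup.isClosed_topologicalClosure _
      isClosed_nodeGp := fun _ => Subgroup.isClosed_topologicalClosure _
      isClosed_cuspGp := fun _ => Subgroup.isClosed_topologicalClosure _
      nodeGp_le := fun m => ⟨(), (), rfl, ⟨1, by rw [one_smul]; exact hN₀ m⟩,
        ⟨1, by rw [one_smul]; exact hN₀ m⟩⟩
      cuspGp_le := fun j => ⟨1, by
        rw [one_smul]
        exact Subgroup.topologicalClosure_mono (Subgroup.map_mono ((Subgroup.zpowers_le).mpr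
          (Subgroup.subset_closure (Or.inr (Or.inr ⟨j, rfl⟩)))))⟩
      proSigma := isProSigma_of_isProSigmaCompletion hι }
  exact ⟨Q, ι, T, Equiv.refl _, (), Equiv.refl _, hι, rfl, rfl, Fintype.card_fin k, Fintype.card_fin r,
    fun _ => rfl, fun w => rfl, fun m => rfl, rfl, rfl, fun _ => rfl⟩

/-! ### F-0459 and F-0458 at origins of irreducible `k`-nodal data -/

section Origin

variable (Ω : PSCOrigin.{u}) (l : ℕ)

/-- **F-0459 / [CombGC] Prop. 1.2 (i) at every origin whose data are of irreducible `k`-nodal shape**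
(profinite `Π`; `(g, r)` hyperbolic, `k ≤ g`). [cite: MochizukiCombGC2007, Prop 1.2(i) p.8] -/
theorem openInterDeterminesComponentHolds_of_irreducibleMultiNodal
    (hΩ : ∀ ⦃Q : Type u⦄ [Group Q] [TopologicalSpace Q] [IsTopologicalGroup Q] (G : PSCDatum Q),
      Ω.IsOfPSCType G → CompactSpace Q ∧ T2Space Q ∧ TotallyDisconnectedSpace Q ∧
        ∃ (S : Set ℕ) (g r k : ℕ) (hk : k ≤ g) (ι : PuncturedSurfaceGroup g r →* Q)
          (e : G.graph.C ≃ Fin r) (v₀ : G.graph.V) (eN : G.graph.N ≃ Fin k),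
          S.Nonempty ∧ (∀ p ∈ S, p.Prime) ∧ IsProSigmaCompletion S ι ∧
          PuncturedSurfaceGroup.IsHyperbolicType g r ∧
          (∀ c, G.cuspGp c =
            ((PuncturedSurfaceGroup.cuspInertia (g := g) (e c)).map ι).topologicalClosure) ∧
          (∀ w, w = v₀) ∧
          (∀ m, G.nodeGp m = ((Subgroup.zpowers
            (PuncturedSurfaceGroup.b (r := r) (Fin.castLE hk (eN m)))).map ι).topologicalClosure)) :
    OpenInterDeterminesComponentHolds Ω := by
  intro Q _ _ _ G hG
  obtain ⟨hc, ht, hd, S, g, r, k, hk, ι, e, v₀, eN, hne, hprime, hι, hhyp, hC, hV, hE⟩ := hΩ G hG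
  exact G.openInterDeterminesComponent_of_irreducibleMultiNodal hne hprime ι hι hk hhyp e hC v₀ hV eN hE

/-- **F-0458 / [CombGC] Thm. 1.6 (i) as printed at every origin whose data are of irreducible `k`-nodal
shape, `Σ = {l}`** (abc-iut-f-164's reduction `numericallyCuspidalIffHolds_of_characterization` from F-0459
above and the vertex-free F-1931). [cite: MochizukiCombGC2007, Thm 1.6(i) p.13] -/
theorem numericallyCuspidalIffHolds_of_irreducibleMultiNodal
    (hΩ : ∀ ⦃Q : Type u⦄ [Group Q] [TopologicalSpace Q] [IsTopologicalGroup Q] (G : PSCDatum Q),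
      Ω.IsOfPSCType G → CompactSpace Q ∧ T2Space Q ∧ TotallyDisconnectedSpace Q ∧
        ∃ (S : Set ℕ) (g r k : ℕ) (hk : k ≤ g) (ι : PuncturedSurfaceGroup g r →* Q)
          (e : G.graph.C ≃ Fin r) (v₀ : G.graph.V) (eN : G.graph.N ≃ Fin k),
          S.Nonempty ∧ (∀ p ∈ S, p.Prime) ∧ IsProSigmaCompletion S ι ∧
          PuncturedSurfaceGroup.IsHyperbolicType g r ∧
          (∀ c, G.cuspGp c =
            ((PuncturedSurfaceGroup.cuspInertia (g := g) (e c)).map ι).topologicalClosure) ∧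
          (∀ w, w = v₀) ∧
          (∀ m, G.nodeGp m = ((Subgroup.zpowers
            (PuncturedSurfaceGroup.b (r := r) (Fin.castLE hk (eN m)))).map ι).topologicalClosure))
    (hSig : ∀ ⦃Q : Type u⦄ [Group Q] [TopologicalSpace Q] [IsTopologicalGroup Q] (G : PSCDatum Q),
      Ω.IsOfPSCType G → G.Sigma = {l}) :
    NumericallyCuspidalIffHolds Ω :=
  numericallyCuspidalIffHolds_of_characterization Ω l
    (fun _ _ _ _ G hG => ⟨(hΩ G hG).1, (hΩ G hG).2.2.1⟩) hSig
    (openInterDeterminesComponentHolds_of_irreducibleMultiNodal Ω hΩ)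
    (cuspidalEdgeLikeCharacterizationHolds_of_cuspidallyStandard Ω fun Q _ _ _ G hG => by
      obtain ⟨hc, ht, hd, S, g, r, k, hk, ι, e, v₀, eN, hne, hprime, hι, hhyp, hC, -⟩ := hΩ G hG
      exact ⟨hc, ht, hd, S, g, r, ι, e, hne, hprime, hhyp, hι, hC⟩)

end Origin

/-! ### The origin with `Σ = {l}`, inhabited by the one-pointed rational curve with two nodes -/

/-- **At the origin of irreducible `k`-nodal data with `Σ = {l}` — inhabited by the pro-`l` datum of the
ONE-POINTED RATIONAL CURVE WITH TWO NODES (`Γ_{2,1}`, `k = 2`: one vertex of genus `0`, nodes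
`closure ι⟨b_0⟩`, `closure ι⟨b_1⟩`, one marked point) — F-0459, F-1931 and F-0458 all HOLD.**  Instance forms
at data of the shape of genuine irreducible nodal curves, not the printed theorems for all pointed stable
curves. [cite: MochizukiCombGC2007, Thm 1.6(i) p.13] [cite: MochizukiCombGC2007, Prop 1.2(i) p.8]
[cite: Mochizuki2012, IUTchI Rmk 1.2.3(iv) pp.41-42] -/
theorem exists_irreducibleMultiNodalOrigin_thm16i_holds (l : ℕ) (hl : l.Prime) :
    ∃ Ω : PSCOrigin.{0},
      (∃ (Q : ProfiniteGrp.{0}) (ι : PuncturedSurfaceGroup 2 1 →* Q) (G : PSCDatum Q)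
        (e : G.graph.C ≃ Fin 1) (v₀ : G.graph.V) (eN : G.graph.N ≃ Fin 2),
        IsProSigmaCompletion {l} ι ∧ Ω.IsOfPSCType G ∧ G.Sigma = {l} ∧ G.graph.i = 1 ∧ G.graph.n = 2 ∧
          G.graph.r = 1 ∧ (∀ w, w = v₀) ∧ G.genus v₀ = 0 ∧ (∀ n, G.graph.nodeEnds n = s(v₀, v₀)) ∧
          (∀ m, G.nodeGp m = ((Subgroup.zpowers
            (PuncturedSurfaceGroup.b (r := 1) (Fin.castLE le_rfl (eN m)))).map ι).topologicalClosure) ∧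
          ∀ c, G.cuspGp c =
            ((PuncturedSurfaceGroup.cuspInertia (g := 2) (e c)).map ι).topologicalClosure) ∧
      OpenInterDeterminesComponentHolds Ω ∧ CuspidalEdgeLikeCharacterizationHolds Ω ∧
      NumericallyCuspidalIffHolds Ω := by
  classical
  let Ω : PSCOrigin.{0} :=
    ⟨fun {Q} _ _ G => ∃ (_ : IsTopologicalGroup Q), G.Sigma = {l} ∧
      (CompactSpace Q ∧ T2Space Q ∧ TotallyDisconnectedSpace Q ∧
        ∃ (S : Set ℕ) (g r k : ℕ) (hk : k ≤ g) (ι : PuncturedSurfaceGroup g r →* Q)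
          (e : G.graph.C ≃ Fin r) (v₀ : G.graph.V) (eN : G.graph.N ≃ Fin k),
          S.Nonempty ∧ (∀ p ∈ S, p.Prime) ∧ IsProSigmaCompletion S ι ∧
          PuncturedSurfaceGroup.IsHyperbolicType g r ∧
          (∀ c, G.cuspGp c =
            ((PuncturedSurfaceGroup.cuspInertia (g := g) (e c)).map ι).topologicalClosure) ∧
          (∀ w, w = v₀) ∧
          (∀ m, G.nodeGp m = ((Subgroup.zpowers
            (PuncturedSurfaceGroup.b (r := r) (Fin.castLE hk (eN m)))).map ι).topologicalClosure))⟩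
  have hΩ : ∀ ⦃Q : Type⦄ [Group Q] [TopologicalSpace Q] [IsTopologicalGroup Q] (G : PSCDatum Q),
      Ω.IsOfPSCType G → CompactSpace Q ∧ T2Space Q ∧ TotallyDisconnectedSpace Q ∧
        ∃ (S : Set ℕ) (g r k : ℕ) (hk : k ≤ g) (ι : PuncturedSurfaceGroup g r →* Q)
          (e : G.graph.C ≃ Fin r) (v₀ : G.graph.V) (eN : G.graph.N ≃ Fin k),
          S.Nonempty ∧ (∀ p ∈ S, p.Prime) ∧ IsProSigmaCompletion S ι ∧
          PuncturedSurfaceGroup.IsHyperbolicType g r ∧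
          (∀ c, G.cuspGp c =
            ((PuncturedSurfaceGroup.cuspInertia (g := g) (e c)).map ι).topologicalClosure) ∧
          (∀ w, w = v₀) ∧
          (∀ m, G.nodeGp m = ((Subgroup.zpowers
            (PuncturedSurfaceGroup.b (r := r) (Fin.castLE hk (eN m)))).map ι).topologicalClosure) :=
    fun Q _ _ _ G hG => hG.2.2
  have hSig : ∀ ⦃Q : Type⦄ [Group Q] [TopologicalSpace Q] [IsTopologicalGroup Q] (G : PSCDatum Q),
      Ω.IsOfPSCType G → G.Sigma = {l} := fun Q _ _ _ G hG => hG.2.1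
  have hl' : ∀ p ∈ ({l} : Set ℕ), p.Prime := fun p hp => by
    rw [Set.mem_singleton_iff.mp hp]; exact hl
  have hhyp : PuncturedSurfaceGroup.IsHyperbolicType 2 1 := by
    unfold PuncturedSurfaceGroup.IsHyperbolicType; norm_num
  refine ⟨Ω, ?_, openInterDeterminesComponentHolds_of_irreducibleMultiNodal Ω hΩ,
    cuspidalEdgeLikeCharacterizationHolds_of_cuspidallyStandard Ω (fun Q _ _ _ G hG => ?_),
    numericallyCuspidalIffHolds_of_irreducibleMultiNodal Ω l hΩ hSig⟩
  · obtain ⟨Q, ι, G, e, v₀, eN, hι, hS, hi, hn, hr, hC, hV, hE, -, hgen, hends⟩ :=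
      exists_irreducibleMultiNodalDatum {l} ⟨l, rfl⟩ hl' 2 1 2 le_rfl
    have hG : Ω.IsOfPSCType G := ⟨inferInstance, hS, inferInstance, inferInstance, inferInstance, {l}, 2, 1,
      2, le_rfl, ι, e, v₀, eN, ⟨l, rfl⟩, hl', hι, hhyp, hC, hV, hE⟩
    exact ⟨Q, ι, G, e, v₀, eN, hι, hG, hS, hi, hn, hr, hV, hgen, hends, hE, hC⟩
  · obtain ⟨hc, ht, hd, S, g, r, k, hk, ι, e, v₀, eN, hne, hprime, hι, hhyp', hC, -⟩ := hΩ G hG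
    exact ⟨hc, ht, hd, S, g, r, ι, e, hne, hprime, hhyp', hι, hC⟩

end PSCDatum

end Literature.AnabelianGeometry.SemiGraphs

end
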